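import Literature.NumberTheory.PAdicHodge.AinfFontaineLimit
import HarnessLib

/-!
# Fontaine's limit is additive: `[u ⊕ u'] = [u] ⊕ [u']` for a binary operation on `𝔫` commuting with `φ`

Topic `Literature/NumberTheory/PAdicHodge`; sequel of `AinfFontaineLimit`. Let `φ : 𝔫 → 𝔫` be contracting and
`⊕ : 𝔫 × 𝔫 → 𝔫` a binary operation which is CONGRUENCE-CONTINUOUS (`a ≡ a'`, `b ≡ b' (mod (p,ξ)^{k+1})` ⇒
`a ⊕ b ≡ a' ⊕ b'`) and commutes with `φ` (`φ(a ⊕ b) = φ a ⊕ φ b`) — e.g. `⊕` the formal group law of `Ê` with values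
in `𝔫 ⊂ 𝔸_inf` and `φ = [p]` (tree `AinfTop.addPt_sub_addPt_mem`, AEC IV.2.3). Then:

* `flim_mem_nilTheta`, `flimPt` — Fontaine's limit lies in `𝔫` (`(p, ξ) ⊆ 𝔫`), so it is again a point;
* `iterate_op` — `φⁿ(a ⊕ b) = φⁿ a ⊕ φⁿ b`;
* **`flim_op`** — for `φ`-compatible sequences `u`, `u'`, the sequence `n ↦ uₙ ⊕ u'ₙ` is `φ`-compatible and
  **`[u ⊕ u'] = [u] ⊕ [u']`**: Fontaine's element of a sum of Tate-module points is the formal-group sum of the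
  elements (Fontaine 1977 Ch. V §1; Colmez 1992 §2 — additivity of the period map).

No definitions besides `flimPt`; no named facts, no `sorry`. Nothing about elliptic curves is proved here.

## References
* J.-M. Fontaine, *Le corps des périodes p-adiques*, Astérisque 223 (1994), Exp. II §1.2.1–1.2.2. [FontaineAsterisque223III]
* J. H. Silverman, *The Arithmetic of Elliptic Curves* (2009), IV.2.3 (`[m]` is a homomorphism). [SilvermanAEC2009]
-/

noncomputable section

open Ideal Filter Topology Field WittVector

namespace Literature.NumberTheory.PAdicHodge

open Literature.NumberTheory.GaloisRepresentations
open Literature.NumberTheory.GaloisRepresentations.IsNonarchimedeanLocalField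
open Literature.NumberTheory.GaloisRepresentations.LubinTate

namespace AinfTop

variable {F : Type} [Field F] [ValuativeRel F] [TopologicalSpace F] [IsNonarchimedeanLocalField F]
  {p : ℕ} [Fact p.Prime] [Fact (¬ IsUnit (p : integerC F))]
  [IsAdicComplete (Ideal.span {(p : integerC F)}) (integerC F)] [CharZero F]
  {hθ : Function.Surjective (fontaineTheta (integerC F) p)}
  {φ : (nilTheta F p hθ).toIdeal → (nilTheta F p hθ).toIdeal}

/-- **Fontaine's limit lies in `𝔫`** (`[u] = φ⁰(u₀) + ([u] − φ⁰(u₀))`, the latter in `(p, ξ) ⊆ 𝔫`).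
[cite: FontaineAsterisque223III, Exp. II §1.2.2] -/
theorem flim_mem_nilTheta (hφ : IsContracting hθ φ) {u : ℕ → (nilTheta F p hθ).toIdeal}
    (hu : ∀ n, ((φ (u (n + 1)) : (nilTheta F p hθ).toIdeal) : AinfTop F p) - u n ∈ (WithIdeal.i : Ideal (AinfTop F p))) :
    flim hφ u hu ∈ (nilTheta F p hθ).toIdeal := by
  have h := flim_sub_approx_mem hφ hu 0
  rw [zero_add, pow_one] at h
  have : flim hφ u hu = (flim hφ u hu - approx φ u 0) + approx φ u 0 := by ring
  rw [this]
  exact Submodule.add_mem _ (ideal_le_nilTheta h) (by rw [approx_def]; exact (u 0).2)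

/-- Fontaine's limit as a point of `𝔫`. [cite: FontaineAsterisque223III, Exp. II §1.2.2] -/
def flimPt (hφ : IsContracting hθ φ) (u : ℕ → (nilTheta F p hθ).toIdeal)
    (hu : ∀ n, ((φ (u (n + 1)) : (nilTheta F p hθ).toIdeal) : AinfTop F p) - u n ∈ (WithIdeal.i : Ideal (AinfTop F p))) :
    (nilTheta F p hθ).toIdeal :=
  ⟨flim hφ u hu, flim_mem_nilTheta hφ hu⟩

/-- Unfolding `flimPt`. [cite: FontaineAsterisque223III, Exp. II §1.2.2] -/
@[simp] theorem coe_flimPt (hφ : IsContracting hθ φ) (u : ℕ → (nilTheta F p hθ).toIdeal)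
    (hu : ∀ n, ((φ (u (n + 1)) : (nilTheta F p hθ).toIdeal) : AinfTop F p) - u n ∈ (WithIdeal.i : Ideal (AinfTop F p))) :
    (flimPt hφ u hu : AinfTop F p) = flim hφ u hu := rfl

variable {op : (nilTheta F p hθ).toIdeal → (nilTheta F p hθ).toIdeal → (nilTheta F p hθ).toIdeal}

/-- `φⁿ(a ⊕ b) = φⁿ a ⊕ φⁿ b` when `φ(a ⊕ b) = φ a ⊕ φ b`. [cite: SilvermanAEC2009, IV.2.3] -/
theorem iterate_op (hop : ∀ a b, φ (op a b) = op (φ a) (φ b)) (n : ℕ) :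
    ∀ a b, φ^[n] (op a b) = op (φ^[n] a) (φ^[n] b) := by
  induction n with
  | zero => intro a b; rfl
  | succ n ih => intro a b; rw [Function.iterate_succ_apply, Function.iterate_succ_apply, Function.iterate_succ_apply, hop, ih]

/-- The sum of two `φ`-compatible sequences is `φ`-compatible (congruence-continuity of `⊕` at level `(p, ξ)`).
[cite: FontaineAsterisque223III, Exp. II §1.2.1] -/
theorem op_compatible
    (hcong : ∀ (k : ℕ) (a a' b b' : (nilTheta F p hθ).toIdeal),
      (a : AinfTop F p) - a' ∈ (WithIdeal.i ^ (k + 1) : Ideal (AinfTop F p)) →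
      (b : AinfTop F p) - b' ∈ (WithIdeal.i ^ (k + 1) : Ideal (AinfTop F p)) →
      (op a b : AinfTop F p) - op a' b' ∈ (WithIdeal.i ^ (k + 1) : Ideal (AinfTop F p)))
    (hop : ∀ a b, φ (op a b) = op (φ a) (φ b)) {u u' : ℕ → (nilTheta F p hθ).toIdeal}
    (hu : ∀ n, ((φ (u (n + 1)) : (nilTheta F p hθ).toIdeal) : AinfTop F p) - u n ∈ (WithIdeal.i : Ideal (AinfTop F p)))
    (hu' : ∀ n, ((φ (u' (n + 1)) : (nilTheta F p hθ).toIdeal) : AinfTop F p) - u' n ∈ (WithIdeal.i : Ideal (AinfTop F p)))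
    (n : ℕ) :
    ((φ (op (u (n + 1)) (u' (n + 1))) : (nilTheta F p hθ).toIdeal) : AinfTop F p) - op (u n) (u' n) ∈
      (WithIdeal.i : Ideal (AinfTop F p)) := by
  rw [hop]
  have h := hcong 0 (φ (u (n + 1))) (u n) (φ (u' (n + 1))) (u' n) (by rw [zero_add, pow_one]; exact hu n)
    (by rw [zero_add, pow_one]; exact hu' n)
  rwa [zero_add, pow_one] at h

/-- **Additivity of Fontaine's limit: `[u ⊕ u'] = [u] ⊕ [u']`.** [cite: FontaineAsterisque223III, Exp. II §1.2.2]
[cite: SilvermanAEC2009, IV.2.3] -/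
theorem flim_op (hφ : IsContracting hθ φ)
    (hcong : ∀ (k : ℕ) (a a' b b' : (nilTheta F p hθ).toIdeal),
      (a : AinfTop F p) - a' ∈ (WithIdeal.i ^ (k + 1) : Ideal (AinfTop F p)) →
      (b : AinfTop F p) - b' ∈ (WithIdeal.i ^ (k + 1) : Ideal (AinfTop F p)) →
      (op a b : AinfTop F p) - op a' b' ∈ (WithIdeal.i ^ (k + 1) : Ideal (AinfTop F p)))
    (hop : ∀ a b, φ (op a b) = op (φ a) (φ b)) {u u' w : ℕ → (nilTheta F p hθ).toIdeal}
    (hw_def : ∀ n, w n = op (u n) (u' n))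
    (hu : ∀ n, ((φ (u (n + 1)) : (nilTheta F p hθ).toIdeal) : AinfTop F p) - u n ∈ (WithIdeal.i : Ideal (AinfTop F p)))
    (hu' : ∀ n, ((φ (u' (n + 1)) : (nilTheta F p hθ).toIdeal) : AinfTop F p) - u' n ∈ (WithIdeal.i : Ideal (AinfTop F p)))
    (hw : ∀ n, ((φ (w (n + 1)) : (nilTheta F p hθ).toIdeal) : AinfTop F p) - w n ∈ (WithIdeal.i : Ideal (AinfTop F p))) :
    flim hφ w hw = (op (flimPt hφ u hu) (flimPt hφ u' hu') : AinfTop F p) := by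
  symm
  refine eq_flim_of_forall_sub_mem hφ hw fun n => ?_
  rw [approx_def, hw_def, iterate_op hop]
  exact hcong n _ _ _ _ (by rw [coe_flimPt, ← approx_def]; exact flim_sub_approx_mem hφ hu n)
    (by rw [coe_flimPt, ← approx_def]; exact flim_sub_approx_mem hφ hu' n)

end AinfTop

end Literature.NumberTheory.PAdicHodge

end
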